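import Literature.Analysis.FluidPDE.CLDataBounds
import HarnessLib

/-!
# Cheskidov–Luo convex integration: estimates on the velocity perturbation (CL22 §5.2)

Analysis/FluidPDE support file (all results proved) for the proof of Prop. 4.1 of A. Cheskidov,
X. Luo, *Sharp nonuniqueness for the Navier–Stokes equations*, Invent. Math. 229 (2022) =
arXiv:2009.06596, §5.2 (numbering of the held arXiv copy), for the explicit perturbation
`w = w^{(p)} + w^{(c)} + w^{(t)}` of `CLPerturbation` (data `D : CL22.Datum d`), in terms of the
parameter-free bound `A` (`D.DataBounds A`, the paper's `C_u`) and the block constant `C`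
(`D.BlockConsts C`, the paper's `≲`) of `CLDataBounds`. With `a = (d-1)/2`, `N = #Λ`:

* POINTWISE MAJORANTS (the shape consumed by `CLEstimateTools`):
  `‖w^{(p)}(t,y)‖ ≤ ∑_x 3A|G_x(t)| |ψ_x(σy)|`, `‖w^{(c)}(t,y)‖ ≤ ∑_x 6A|G_x(t)| ∑ⱼ|∂ⱼP_x(y)|`,
  `‖w^{(t)}(t,y)‖ ≤ N ν⁻¹ A`, and for the gradients (with the explicit formulas `partialDeriv_wp`,
  `partialDeriv_wc`, `partialDeriv_wt`): `‖∂ᵢw^{(p)}‖ ≤ ∑_x 3A|G_x|(|ψ_x(σ·)| + |∂ᵢ[ψ_x(σ·)]|)`,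
  `‖∂ᵢw^{(c)}‖ ≤ ∑_x 6A|G_x|(∑ⱼ|∂ⱼP_x| + ∑ⱼ|∂ᵢ∂ⱼP_x|)`, `‖∂ᵢw^{(t)}‖ ≤ N ν⁻¹ A`;
* SLICE BOUNDS: `‖w^{(p)}(t)‖_{L^r} ≤ ∑_x 3ACμ^{a-(d-1)/r}|G_x(t)|`, `‖w^{(p)}(t)‖_∞ ≤ ∑_x 3ACμ^a|G_x(t)|`,
  `‖w^{(c)}(t)‖_∞ ≤ ∑_x 6AdCσ⁻¹μ^{a-1}|G_x(t)|`, `‖∂ᵢw^{(p)}(t)‖_{L^r} ≤ ∑_x 6ACσμ^{a+1-(d-1)/r}|G_x(t)|`,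
  `‖∂ᵢw^{(c)}(t)‖_{L^r} ≤ ∑_x 12AdCμ^{a-(d-1)/r}|G_x(t)|` (CL22 Props. 5.3–5.4: "taking `L^∞`
  (`L^r`, `W^{1,q}`) norm in space");
* TIME-INTEGRATED BOUNDS: `‖w^{(p)}‖_{L^p(0,T;L^∞)} ≤ 3NA²C(T+1)^{1/p} κ^{1/2-1/p} μ^a` (Prop. 5.3:
  "`‖w^{(p)}‖_{L^pL^∞} ≤ C_u κ^{1/2-1/p} μ^{(d-1)/2}`"), `‖w^{(c)}‖_{L^q(0,T;L^∞)} ≤ 6NA²dC(T+1)σ⁻¹μ^{a-1}`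
  for `1 ≤ q ≤ 2` (Prop. 5.4), `‖w^{(t)}‖_{L^q(0,T;L^s)} ≤ max(1,T) N A ν⁻¹` (Prop. 5.5), and the
  `L¹_t L^r_x` sizes of `w^{(p)}`, `w^{(c)}`, `∇w^{(p)}`, `∇w^{(c)}`, `∇w^{(t)}` with the gain
  `∫₀ᵀ|G_x| ≤ (T+1)κ^{-1/2}A` of the intermittent time profile.

The energy estimate (Prop. 5.3, `L²_{t,x}`) is in the sibling file `CLEnergyEstimate`.

## References

* A. Cheskidov, X. Luo, arXiv:2009.06596, §5.2 Lemma 5.2, Props. 5.3–5.5. [`CheskidovLuo2022`]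
-/

noncomputable section

open Set Filter Topology Function MeasureTheory Finset
open scoped ContDiff ENNReal

namespace Literature.Analysis.FluidPDE

namespace CL22

open FunctionSpaces NashGeometric Mikado Intermittent

variable {d : Type*} [Fintype d] [DecidableEq d]

/-! ## The direction vectors -/

/-- `‖k_x‖² = |k_x|²` (`= 1` or `5`). [folklore] -/
theorem norm_dirVec_sq (x : Index d) : ‖dirVec x‖ ^ 2 = dirNormSq x := by
  rw [EuclideanSpace.norm_sq_eq, ← sum_sq_dir x]
  exact Finset.sum_congr rfl fun l _ => by simp [dirVec, sq_abs]

omit [Fintype d] [DecidableEq d] in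
/-- `|k_x|² ≤ 5`. [folklore] -/
theorem dirNormSq_le (x : Index d) : dirNormSq x ≤ 5 := by
  rcases x with i | p | p <;> simp

/-- `‖k_x‖ ≤ 3`. [folklore] -/
theorem norm_dirVec_le (x : Index d) : ‖dirVec x‖ ≤ 3 := by
  have h := norm_dirVec_sq x
  nlinarith [dirNormSq_le x, norm_nonneg (dirVec x)]

/-- `|(k_x)ₗ| ≤ 3`. [folklore] -/
theorem abs_dir_le (x : Index d) (l : d) : |((dir x l : ℤ) : ℝ)| ≤ 3 :=
  (Torus.abs_apply_le_norm (dirVec x) l).trans (norm_dirVec_le x)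

omit [DecidableEq d] in
/-- `‖V‖ ≤ ∑ᵢ |Vᵢ|` on `ℝ^d` (private copy; cf. `NSRPerturbation`). [folklore] -/
private theorem norm_le_sum_abs' (V : EuclideanSpace ℝ d) : ‖V‖ ≤ ∑ i, |V i| := by
  rw [EuclideanSpace.norm_eq]
  have h0 : 0 ≤ ∑ i, |V i| := Finset.sum_nonneg fun _ _ => abs_nonneg _
  rw [Real.sqrt_le_left h0]
  calc ∑ i, ‖V i‖ ^ 2 = ∑ i, |V i| ^ 2 := by simp [Real.norm_eq_abs]
    _ ≤ (∑ i, |V i|) ^ 2 := Finset.sum_sq_le_sq_sum_of_nonneg fun i _ => abs_nonneg _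

namespace Datum

variable {D : Datum d} (h : D.Valid) {A C : ℝ} (hA : D.DataBounds A) (hC : D.BlockConsts C)

/-! ## Pointwise majorants of `w^{(p)}`, `w^{(c)}`, `w^{(t)}` -/

section Pointwise

include h in
/-- **`‖Ω̃_x(y)v‖ ≤ 2‖k_x‖‖v‖ ∑ⱼ|∂ⱼP_x(y)|`** (`Ω̃_x v = (∇P_x·v)k_x - (k_x·v)∇P_x`). [folklore] -/
theorem norm_omegaApply_le (x : Index d) (y : UnitAddTorus d) (v : EuclideanSpace ℝ d) :
    ‖D.omegaApply x y v‖ ≤ 2 * ‖dirVec x‖ * ‖v‖ * ∑ j, |Torus.partialDeriv j (D.P x) y| := by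
  have hP1 : Torus.IsContDiff 1 (D.P x) := (isSmooth_P h x).isContDiff (by simp)
  have hS0 : 0 ≤ ∑ j, |Torus.partialDeriv j (D.P x) y| := Finset.sum_nonneg fun _ _ => abs_nonneg _
  have h1 : |∑ j, Torus.partialDeriv j (D.P x) y * v j| ≤ ‖v‖ * ∑ j, |Torus.partialDeriv j (D.P x) y| := by
    calc |∑ j, Torus.partialDeriv j (D.P x) y * v j| ≤ ∑ j, |Torus.partialDeriv j (D.P x) y * v j| :=
          Finset.abs_sum_le_sum_abs _ _
      _ ≤ ∑ j, |Torus.partialDeriv j (D.P x) y| * ‖v‖ := Finset.sum_le_sum fun j _ => by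
          rw [abs_mul]; exact mul_le_mul_of_nonneg_left (Torus.abs_apply_le_norm v j) (abs_nonneg _)
      _ = ‖v‖ * ∑ j, |Torus.partialDeriv j (D.P x) y| := by rw [← Finset.sum_mul, mul_comm]
  have h2 : |∑ j, ((dir x j : ℤ) : ℝ) * v j| ≤ ‖dirVec x‖ * ‖v‖ := by
    have := Torus.abs_sum_mul_apply_le (dirVec x) v
    simpa [dirVec] using this
  have h3 : ‖Torus.gradient (D.P x) y‖ ≤ ∑ j, |Torus.partialDeriv j (D.P x) y| :=
    (norm_le_sum_abs' _).trans (le_of_eq (Finset.sum_congr rfl fun j _ => by rw [Torus.gradient_apply hP1]))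
  unfold Datum.omegaApply
  calc ‖(∑ j, Torus.partialDeriv j (D.P x) y * v j) • dirVec x - (∑ j, ((dir x j : ℤ) : ℝ) * v j) • Torus.gradient (D.P x) y‖
      ≤ ‖(∑ j, Torus.partialDeriv j (D.P x) y * v j) • dirVec x‖ + ‖(∑ j, ((dir x j : ℤ) : ℝ) * v j) • Torus.gradient (D.P x) y‖ :=
        norm_sub_le _ _
    _ = |∑ j, Torus.partialDeriv j (D.P x) y * v j| * ‖dirVec x‖ + |∑ j, ((dir x j : ℤ) : ℝ) * v j| * ‖Torus.gradient (D.P x) y‖ := by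
        rw [norm_smul, norm_smul, Real.norm_eq_abs, Real.norm_eq_abs]
    _ ≤ (‖v‖ * ∑ j, |Torus.partialDeriv j (D.P x) y|) * ‖dirVec x‖ + (‖dirVec x‖ * ‖v‖) * ∑ j, |Torus.partialDeriv j (D.P x) y| := by
        gcongr
    _ = 2 * ‖dirVec x‖ * ‖v‖ * ∑ j, |Torus.partialDeriv j (D.P x) y| := by ring

include hA in
/-- **`‖w^{(p)}(t,y)‖ ≤ ∑_x 3A |G_x(t)| |ψ_x(σy)|`** on `[0,T]`. [cite: CheskidovLuo2022, Prop. 5.3] -/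
theorem norm_wp_le {t : ℝ} (ht : t ∈ Icc 0 D.T) (y : UnitAddTorus d) :
    ‖D.wp t y‖ ≤ ∑ x, (3 * A * |D.G x t|) * |D.Ψ x y| := by
  unfold Datum.wp
  refine (norm_sum_le _ _).trans (Finset.sum_le_sum fun x _ => ?_)
  rw [norm_smul, Real.norm_eq_abs, abs_mul, abs_mul]
  have h1 := hA.atil_le x t ht y
  have h2 := norm_dirVec_le x
  have h3 : 0 ≤ |D.G x t| * |D.Ψ x y| := by positivity
  calc |D.G x t| * |D.atil x t y| * |D.Ψ x y| * ‖dirVec x‖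
      ≤ |D.G x t| * A * |D.Ψ x y| * 3 := by
        have := mul_le_mul h1 h2 (norm_nonneg _) hA.nonneg
        nlinarith [abs_nonneg (D.atil x t y), norm_nonneg (dirVec x)]
    _ = 3 * A * |D.G x t| * |D.Ψ x y| := by ring

include h hA in
/-- **`‖w^{(c)}(t,y)‖ ≤ ∑_x 6A |G_x(t)| ∑ⱼ|∂ⱼP_x(y)|`** on `[0,T]`. [cite: CheskidovLuo2022, Prop. 5.4] -/
theorem norm_wc_le {t : ℝ} (ht : t ∈ Icc 0 D.T) (y : UnitAddTorus d) :
    ‖D.wc t y‖ ≤ ∑ x, (6 * A * |D.G x t|) * |(∑ j, |Torus.partialDeriv j (D.P x) y|)| := by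
  unfold Datum.wc
  refine (norm_sum_le _ _).trans (Finset.sum_le_sum fun x _ => ?_)
  have hS0 : 0 ≤ ∑ j, |Torus.partialDeriv j (D.P x) y| := Finset.sum_nonneg fun _ _ => abs_nonneg _
  rw [norm_smul, Real.norm_eq_abs, abs_of_nonneg hS0]
  have h1 := norm_omegaApply_le h x y (D.gradA x t y)
  have h2 := hA.gradA_le x t ht y
  have h3 := norm_dirVec_le x
  calc |D.G x t| * ‖D.omegaApply x y (D.gradA x t y)‖
      ≤ |D.G x t| * (2 * ‖dirVec x‖ * ‖D.gradA x t y‖ * ∑ j, |Torus.partialDeriv j (D.P x) y|) :=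
        mul_le_mul_of_nonneg_left h1 (abs_nonneg _)
    _ ≤ |D.G x t| * (2 * 3 * A * ∑ j, |Torus.partialDeriv j (D.P x) y|) := by
        refine mul_le_mul_of_nonneg_left ?_ (abs_nonneg _)
        refine mul_le_mul_of_nonneg_right ?_ hS0
        nlinarith [norm_nonneg (dirVec x), norm_nonneg (D.gradA x t y), hA.nonneg]
    _ = 6 * A * |D.G x t| * ∑ j, |Torus.partialDeriv j (D.P x) y| := by ring

include h hA in
/-- **`‖w^{(t)}(t,y)‖ ≤ N ν⁻¹ A`** on `[0,T]` (`|H_x| ≤ ν⁻¹`, `θ² ≤ 1`, `‖Z_x‖ ≤ A`; CL22 Prop. 5.5: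
"`‖w^{(t)}‖_{L^∞W^{1,∞}} ≤ C_u ν⁻¹`"). [cite: CheskidovLuo2022, Prop. 5.5] -/
theorem norm_wt_le {t : ℝ} (ht : t ∈ Icc 0 D.T) (y : UnitAddTorus d) :
    ‖D.wt t y‖ ≤ Fintype.card (Index d) * D.ν⁻¹ * A := by
  unfold Datum.wt
  rw [norm_neg]
  refine (norm_sum_le _ _).trans ?_
  have hθ := h.hθ01 t
  have hθ2 : D.θ t ^ 2 ≤ 1 := by nlinarith [hθ.1, hθ.2]
  calc ∑ x, ‖(D.H x t * D.θ t ^ 2) • D.Z x t y‖ ≤ ∑ _x : Index d, D.ν⁻¹ * A := Finset.sum_le_sum fun x _ => by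
        rw [norm_smul, Real.norm_eq_abs, abs_mul, abs_of_nonneg (sq_nonneg (D.θ t))]
        have h1 := abs_H_le h x t
        have h2 := hA.Z_le x t ht y
        calc |D.H x t| * D.θ t ^ 2 * ‖D.Z x t y‖ ≤ D.ν⁻¹ * 1 * A :=
              mul_le_mul (mul_le_mul h1 hθ2 (sq_nonneg _) (inv_nonneg.2 (by linarith [h.hν]))) h2 (norm_nonneg _)
                (mul_nonneg (inv_nonneg.2 (by linarith [h.hν])) zero_le_one)
          _ = D.ν⁻¹ * A := by ring
    _ = Fintype.card (Index d) * D.ν⁻¹ * A := by rw [Finset.sum_const, Finset.card_univ, nsmul_eq_mul]; ring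

end Pointwise

/-! ## The gradients: formulas and majorants -/

section Gradient

include h in
/-- **`∂ᵢw^{(p)} = ∑_x G_x (∂ᵢã_x ψ_x(σ·) + ã_x ∂ᵢ[ψ_x(σ·)]) k_x`** on `[0,T]`. [folklore] -/
theorem partialDeriv_wp {t : ℝ} (ht : t ∈ Icc 0 D.T) (i : d) (y : UnitAddTorus d) :
    Torus.partialDeriv i (D.wp t) y =
      ∑ x, (D.G x t * (Torus.partialDeriv i (D.atil x t) y * D.Ψ x y + D.atil x t y * Torus.partialDeriv i (D.Ψ x) y)) •
        dirVec x := by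
  have ha : ∀ x, Torus.IsContDiff 1 (D.atil x t) := fun x => (isSmooth_atil h x ht).isContDiff (by simp)
  have hΨ : ∀ x, Torus.IsContDiff 1 (D.Ψ x) := fun x => (isSmooth_Ψ h x).isContDiff (by simp)
  have hf : ∀ x, Torus.IsContDiff 1 (fun y => D.G x t * D.atil x t y * D.Ψ x y) := fun x =>
    ((contDiff_const.mul (ha x)).mul (hΨ x))
  have hfk : ∀ x, Torus.IsContDiff 1 (fun z => (D.G x t * D.atil x t z * D.Ψ x z) • dirVec x) := fun x =>
    ContDiff.smul (hf x) contDiff_const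
  have e : D.wp t = fun y => ∑ x, (fun z => (D.G x t * D.atil x t z * D.Ψ x z) • dirVec x) y := by
    funext z; simp [Datum.wp]
  rw [e, Torus.partialDeriv_finset_sum _ (fun x _ => hfk x)]
  refine Finset.sum_congr rfl fun x _ => ?_
  rw [Torus.partialDeriv_smul (hf x) ((Torus.isSmooth_const _).isContDiff (by simp)), Torus.partialDeriv_const_apply,
    smul_zero, zero_add]
  congr 1
  have haΨ : Torus.IsContDiff 1 (fun y => D.atil x t y * D.Ψ x y) := (ha x).mul (hΨ x)
  have e2 : (fun y => D.G x t * D.atil x t y * D.Ψ x y) = fun y => D.G x t * (D.atil x t y * D.Ψ x y) := by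
    funext z; ring
  rw [e2, Torus.partialDeriv_const_mul_apply haΨ, Torus.partialDeriv_mul (ha x) (hΨ x)]
  ring

include h hA in
/-- **`‖∂ᵢw^{(p)}(t,y)‖ ≤ ∑_x 3A|G_x(t)| (|ψ_x(σy)| + |∂ᵢ[ψ_x(σ·)](y)|)`**. [cite: CheskidovLuo2022, Prop. 5.3] -/
theorem norm_partialDeriv_wp_le {t : ℝ} (ht : t ∈ Icc 0 D.T) (i : d) (y : UnitAddTorus d) :
    ‖Torus.partialDeriv i (D.wp t) y‖ ≤
      ∑ x, (3 * A * |D.G x t|) * |(|D.Ψ x y| + |Torus.partialDeriv i (D.Ψ x) y|)| := by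
  rw [partialDeriv_wp h ht i y]
  refine (norm_sum_le _ _).trans (Finset.sum_le_sum fun x _ => ?_)
  rw [abs_of_nonneg (by positivity : 0 ≤ |D.Ψ x y| + |Torus.partialDeriv i (D.Ψ x) y|), norm_smul, Real.norm_eq_abs,
    abs_mul]
  have h1 := hA.atil_le x t ht y
  have h2 : |Torus.partialDeriv i (D.atil x t) y| ≤ A := by
    have h3 := hA.gradA_le x t ht y
    have h4 : |D.gradA x t y i| ≤ ‖D.gradA x t y‖ := Torus.abs_apply_le_norm _ i
    rw [Datum.gradA, Torus.gradient_apply ((isSmooth_atil h x ht).isContDiff (by simp))] at h4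
    exact h4.trans h3
  have hk := norm_dirVec_le x
  have h5 : |Torus.partialDeriv i (D.atil x t) y * D.Ψ x y + D.atil x t y * Torus.partialDeriv i (D.Ψ x) y| ≤
      A * (|D.Ψ x y| + |Torus.partialDeriv i (D.Ψ x) y|) := by
    refine (abs_add_le _ _).trans ?_
    rw [abs_mul, abs_mul, mul_add]
    exact add_le_add (mul_le_mul_of_nonneg_right h2 (abs_nonneg _)) (mul_le_mul_of_nonneg_right h1 (abs_nonneg _))
  calc |D.G x t| * |Torus.partialDeriv i (D.atil x t) y * D.Ψ x y + D.atil x t y * Torus.partialDeriv i (D.Ψ x) y| * ‖dirVec x‖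
      ≤ |D.G x t| * (A * (|D.Ψ x y| + |Torus.partialDeriv i (D.Ψ x) y|)) * 3 :=
        mul_le_mul (mul_le_mul_of_nonneg_left h5 (abs_nonneg _)) hk (norm_nonneg _)
          (mul_nonneg (abs_nonneg _) (mul_nonneg hA.nonneg (by positivity)))
    _ = 3 * A * |D.G x t| * (|D.Ψ x y| + |Torus.partialDeriv i (D.Ψ x) y|) := by ring

include h in
/-- **The gradient of the corrector**: with `g = ∇ã_x(t,·)`,
`∂ᵢ(Ω̃_x[g]) = (∑ⱼ(∂ⱼP_x ∂ᵢgⱼ + ∂ᵢ∂ⱼP_x gⱼ)) k_x - (k_x·∂ᵢg) ∇P_x - (k_x·g) ∂ᵢ∇P_x`. [folklore] -/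
theorem partialDeriv_omegaApply {t : ℝ} (ht : t ∈ Icc 0 D.T) (x : Index d) (i : d) (y : UnitAddTorus d) :
    Torus.partialDeriv i (fun z => D.omegaApply x z (D.gradA x t z)) y =
      (∑ j, (Torus.partialDeriv j (D.P x) y * Torus.partialDeriv i (D.gradA x t) y j +
          Torus.partialDeriv i (Torus.partialDeriv j (D.P x)) y * D.gradA x t y j)) • dirVec x -
        ((∑ j, ((dir x j : ℤ) : ℝ) * Torus.partialDeriv i (D.gradA x t) y j) • Torus.gradient (D.P x) y +
          (∑ j, ((dir x j : ℤ) : ℝ) * D.gradA x t y j) • Torus.partialDeriv i (Torus.gradient (D.P x)) y) := by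
  have hP : Torus.IsSmooth (D.P x) := isSmooth_P h x
  have hg : Torus.IsSmooth (D.gradA x t) := (smooth_gradA h x).isSmooth_slice ht
  have h1P : ∀ j, Torus.IsContDiff 1 (Torus.partialDeriv j (D.P x)) := fun j => (hP.partialDeriv j).isContDiff (by simp)
  have h1g : ∀ j, Torus.IsContDiff 1 (fun z => D.gradA x t z j) := fun j => (hg.apply j).isContDiff (by simp)
  have hgrad : Torus.IsContDiff 1 (Torus.gradient (D.P x)) := hP.gradient.isContDiff (by simp)
  have hm1 : ∀ j, Torus.IsContDiff 1 (fun z => Torus.partialDeriv j (D.P x) z * D.gradA x t z j) := fun j =>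
    (h1P j).mul (h1g j)
  have hm2 : ∀ j, Torus.IsContDiff 1 (fun z => ((dir x j : ℤ) : ℝ) * D.gradA x t z j) := fun j =>
    (Torus.isSmooth_const _ |>.isContDiff (by simp)).mul (h1g j)
  have hs1 : Torus.IsContDiff 1 (fun z => ∑ j, Torus.partialDeriv j (D.P x) z * D.gradA x t z j) :=
    ContDiff.sum fun j _ => hm1 j
  have hs2 : Torus.IsContDiff 1 (fun z => ∑ j, ((dir x j : ℤ) : ℝ) * D.gradA x t z j) :=
    ContDiff.sum fun j _ => hm2 j
  have hF1 : Torus.IsContDiff 1 (fun z => (∑ j, Torus.partialDeriv j (D.P x) z * D.gradA x t z j) • dirVec x) :=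
    ContDiff.smul hs1 contDiff_const
  have hF2 : Torus.IsContDiff 1 (fun z => -((∑ j, ((dir x j : ℤ) : ℝ) * D.gradA x t z j) • Torus.gradient (D.P x) z)) :=
    ContDiff.neg (ContDiff.smul hs2 hgrad)
  have e : (fun z => D.omegaApply x z (D.gradA x t z)) =
      (fun z => (∑ j, Torus.partialDeriv j (D.P x) z * D.gradA x t z j) • dirVec x) +
        fun z => -((∑ j, ((dir x j : ℤ) : ℝ) * D.gradA x t z j) • Torus.gradient (D.P x) z) := by
    funext z; simp [Datum.omegaApply, sub_eq_add_neg]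
  rw [e, Torus.partialDeriv_add hF1 hF2, Pi.add_apply, Torus.partialDeriv_neg, ← sub_eq_add_neg]
  congr 1
  · rw [Torus.partialDeriv_smul hs1 ((Torus.isSmooth_const _).isContDiff (by simp)), Torus.partialDeriv_const_apply,
      smul_zero, zero_add, Torus.partialDeriv_finset_sum _ (fun j _ => hm1 j)]
    congr 1
    refine Finset.sum_congr rfl fun j _ => ?_
    rw [Torus.partialDeriv_mul (h1P j) (h1g j), Torus.partialDeriv_apply_coord (hg.isContDiff (by simp))]
  · rw [Torus.partialDeriv_smul hs2 hgrad, Torus.partialDeriv_finset_sum _ (fun j _ => hm2 j), add_comm]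
    congr 1
    congr 1
    refine Finset.sum_congr rfl fun j _ => ?_
    rw [Torus.partialDeriv_const_mul_apply (h1g j), Torus.partialDeriv_apply_coord (hg.isContDiff (by simp))]

include h in
/-- **`∂ᵢw^{(c)} = ∑_x G_x ∂ᵢ(Ω̃_x[∇ã_x])`** on `[0,T]`. [folklore] -/
theorem partialDeriv_wc {t : ℝ} (ht : t ∈ Icc 0 D.T) (i : d) (y : UnitAddTorus d) :
    Torus.partialDeriv i (D.wc t) y = ∑ x, D.G x t • Torus.partialDeriv i (fun z => D.omegaApply x z (D.gradA x t z)) y := by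
  have hsm : ∀ x, Torus.IsContDiff 1 (fun z => D.omegaApply x z (D.gradA x t z)) := fun x =>
    ((smooth_omegaApply h x (smooth_gradA h x)).isSmooth_slice ht).isContDiff (by simp)
  have e : D.wc t = fun y => ∑ x, (D.G x t • fun z => D.omegaApply x z (D.gradA x t z)) y := by
    funext z; simp [Datum.wc]
  rw [e, Torus.partialDeriv_finset_sum _ (fun x _ => (hsm x).smul (D.G x t))]
  refine Finset.sum_congr rfl fun x _ => ?_
  rw [Torus.partialDeriv_const_smul (hsm x) (D.G x t) i, Pi.smul_apply]

include h hA in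
/-- **`‖∂ᵢw^{(c)}(t,y)‖ ≤ ∑_x 6A|G_x(t)| (∑ⱼ|∂ⱼP_x(y)| + ∑ⱼ|∂ᵢ∂ⱼP_x(y)|)`**. [cite: CheskidovLuo2022, Prop. 5.4] -/
theorem norm_partialDeriv_wc_le {t : ℝ} (ht : t ∈ Icc 0 D.T) (i : d) (y : UnitAddTorus d) :
    ‖Torus.partialDeriv i (D.wc t) y‖ ≤
      ∑ x, (6 * A * |D.G x t|) *
        |((∑ j, |Torus.partialDeriv j (D.P x) y|) + ∑ j, |Torus.partialDeriv i (Torus.partialDeriv j (D.P x)) y|)| := by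
  rw [partialDeriv_wc h ht i y]
  refine (norm_sum_le _ _).trans (Finset.sum_le_sum fun x _ => ?_)
  rw [partialDeriv_omegaApply h ht x i y]
  set S₁ := ∑ j, |Torus.partialDeriv j (D.P x) y| with hS₁
  set S₂ := ∑ j, |Torus.partialDeriv i (Torus.partialDeriv j (D.P x)) y| with hS₂
  have hS₁0 : 0 ≤ S₁ := Finset.sum_nonneg fun _ _ => abs_nonneg _
  have hS₂0 : 0 ≤ S₂ := Finset.sum_nonneg fun _ _ => abs_nonneg _
  rw [abs_of_nonneg (by positivity : 0 ≤ S₁ + S₂), norm_smul, Real.norm_eq_abs]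
  have hP : Torus.IsSmooth (D.P x) := isSmooth_P h x
  have hP1 : Torus.IsContDiff 1 (D.P x) := hP.isContDiff (by simp)
  have hg0 : ‖D.gradA x t y‖ ≤ A := hA.gradA_le x t ht y
  have hg1 : ‖Torus.partialDeriv i (D.gradA x t) y‖ ≤ A := hA.dgradA_le x i t ht y
  have hk := norm_dirVec_le x
  -- the three pieces
  have p1 : |∑ j, (Torus.partialDeriv j (D.P x) y * Torus.partialDeriv i (D.gradA x t) y j +
      Torus.partialDeriv i (Torus.partialDeriv j (D.P x)) y * D.gradA x t y j)| ≤ A * S₁ + A * S₂ := by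
    refine (Finset.abs_sum_le_sum_abs _ _).trans ?_
    rw [hS₁, hS₂, Finset.mul_sum, Finset.mul_sum, ← Finset.sum_add_distrib]
    refine Finset.sum_le_sum fun j _ => (abs_add_le _ _).trans ?_
    rw [abs_mul, abs_mul]
    have a1 : |Torus.partialDeriv i (D.gradA x t) y j| ≤ A := (Torus.abs_apply_le_norm _ j).trans hg1
    have a2 : |D.gradA x t y j| ≤ A := (Torus.abs_apply_le_norm _ j).trans hg0
    calc |Torus.partialDeriv j (D.P x) y| * |Torus.partialDeriv i (D.gradA x t) y j| +
          |Torus.partialDeriv i (Torus.partialDeriv j (D.P x)) y| * |D.gradA x t y j|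
        ≤ |Torus.partialDeriv j (D.P x) y| * A + |Torus.partialDeriv i (Torus.partialDeriv j (D.P x)) y| * A := by
          gcongr
      _ = A * |Torus.partialDeriv j (D.P x) y| + A * |Torus.partialDeriv i (Torus.partialDeriv j (D.P x)) y| := by ring
  have p2 : |∑ j, ((dir x j : ℤ) : ℝ) * Torus.partialDeriv i (D.gradA x t) y j| ≤ 3 * A := by
    have := Torus.abs_sum_mul_apply_le (dirVec x) (Torus.partialDeriv i (D.gradA x t) y)
    have h' : |∑ j, ((dir x j : ℤ) : ℝ) * Torus.partialDeriv i (D.gradA x t) y j| ≤ ‖dirVec x‖ * ‖Torus.partialDeriv i (D.gradA x t) y‖ := by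
      simpa [dirVec] using this
    exact h'.trans (mul_le_mul hk hg1 (norm_nonneg _) (by norm_num))
  have p3 : |∑ j, ((dir x j : ℤ) : ℝ) * D.gradA x t y j| ≤ 3 * A := by
    have := Torus.abs_sum_mul_apply_le (dirVec x) (D.gradA x t y)
    have h' : |∑ j, ((dir x j : ℤ) : ℝ) * D.gradA x t y j| ≤ ‖dirVec x‖ * ‖D.gradA x t y‖ := by simpa [dirVec] using this
    exact h'.trans (mul_le_mul hk hg0 (norm_nonneg _) (by norm_num))
  have q1 : ‖Torus.gradient (D.P x) y‖ ≤ S₁ :=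
    (norm_le_sum_abs' _).trans (le_of_eq (Finset.sum_congr rfl fun j _ => by rw [Torus.gradient_apply hP1]))
  have q2 : ‖Torus.partialDeriv i (Torus.gradient (D.P x)) y‖ ≤ S₂ := by
    refine (norm_le_sum_abs' _).trans (le_of_eq (Finset.sum_congr rfl fun j _ => ?_))
    rw [← Torus.partialDeriv_apply_coord (hP.gradient.isContDiff (by simp))]
    congr 2
    funext z
    exact Torus.gradient_apply hP1 z j
  have hA0 := hA.nonneg
  calc |D.G x t| * ‖(∑ j, (Torus.partialDeriv j (D.P x) y * Torus.partialDeriv i (D.gradA x t) y j +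
          Torus.partialDeriv i (Torus.partialDeriv j (D.P x)) y * D.gradA x t y j)) • dirVec x -
        ((∑ j, ((dir x j : ℤ) : ℝ) * Torus.partialDeriv i (D.gradA x t) y j) • Torus.gradient (D.P x) y +
          (∑ j, ((dir x j : ℤ) : ℝ) * D.gradA x t y j) • Torus.partialDeriv i (Torus.gradient (D.P x)) y)‖
      ≤ |D.G x t| * ((A * S₁ + A * S₂) * 3 + (3 * A * S₁ + 3 * A * S₂)) := by
        refine mul_le_mul_of_nonneg_left ?_ (abs_nonneg _)
        refine (norm_sub_le _ _).trans (add_le_add ?_ ((norm_add_le _ _).trans (add_le_add ?_ ?_)))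
        · rw [norm_smul, Real.norm_eq_abs]; exact mul_le_mul p1 hk (norm_nonneg _) (by positivity)
        · rw [norm_smul, Real.norm_eq_abs]; exact mul_le_mul p2 q1 (norm_nonneg _) (by positivity)
        · rw [norm_smul, Real.norm_eq_abs]; exact mul_le_mul p3 q2 (norm_nonneg _) (by positivity)
    _ = 6 * A * |D.G x t| * (S₁ + S₂) := by ring

include h in
/-- **`∂ᵢw^{(t)} = -∑_x H_x θ² ∂ᵢZ_x`** on `[0,T]`. [folklore] -/
theorem partialDeriv_wt {t : ℝ} (ht : t ∈ Icc 0 D.T) (i : d) (y : UnitAddTorus d) :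
    Torus.partialDeriv i (D.wt t) y = -∑ x, (D.H x t * D.θ t ^ 2) • Torus.partialDeriv i (D.Z x t) y := by
  have hZ : ∀ x, Torus.IsContDiff 1 (D.Z x t) := fun x => (isSmooth_Z h x ht).isContDiff (by simp)
  have e : D.wt t = fun y => -((fun y' => ∑ x, ((D.H x t * D.θ t ^ 2) • D.Z x t) y') y) := by
    funext z; simp [Datum.wt]
  rw [e, Torus.partialDeriv_neg, Torus.partialDeriv_finset_sum _ (fun x _ => (hZ x).smul _)]
  congr 1
  refine Finset.sum_congr rfl fun x _ => ?_
  rw [Torus.partialDeriv_const_smul (hZ x) _ i, Pi.smul_apply]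

include h hA in
/-- **`‖∂ᵢw^{(t)}(t,y)‖ ≤ N ν⁻¹ A`**. [cite: CheskidovLuo2022, Prop. 5.5] -/
theorem norm_partialDeriv_wt_le {t : ℝ} (ht : t ∈ Icc 0 D.T) (i : d) (y : UnitAddTorus d) :
    ‖Torus.partialDeriv i (D.wt t) y‖ ≤ Fintype.card (Index d) * D.ν⁻¹ * A := by
  rw [partialDeriv_wt h ht i y, norm_neg]
  refine (norm_sum_le _ _).trans ?_
  have hθ := h.hθ01 t
  have hθ2 : D.θ t ^ 2 ≤ 1 := by nlinarith [hθ.1, hθ.2]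
  have hν0 : 0 ≤ D.ν⁻¹ := inv_nonneg.2 (by linarith [h.hν])
  calc ∑ x, ‖(D.H x t * D.θ t ^ 2) • Torus.partialDeriv i (D.Z x t) y‖ ≤ ∑ _x : Index d, D.ν⁻¹ * A :=
        Finset.sum_le_sum fun x _ => by
          rw [norm_smul, Real.norm_eq_abs, abs_mul, abs_of_nonneg (sq_nonneg (D.θ t))]
          calc |D.H x t| * D.θ t ^ 2 * ‖Torus.partialDeriv i (D.Z x t) y‖ ≤ D.ν⁻¹ * 1 * A :=
                mul_le_mul (mul_le_mul (abs_H_le h x t) hθ2 (sq_nonneg _) hν0) (hA.dZ_le x i t ht y) (norm_nonneg _)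
                  (mul_nonneg hν0 zero_le_one)
            _ = D.ν⁻¹ * A := by ring
    _ = Fintype.card (Index d) * D.ν⁻¹ * A := by rw [Finset.sum_const, Finset.card_univ, nsmul_eq_mul]; ring

end Gradient

/-! ## Slice bounds -/

section Slice

omit [DecidableEq d] in
include h in
/-- The exponent of `μ` in `‖ψ_x‖_{L^r}` is at most `a`: `μ^{a-(d-1)/r} ≤ μ^a` (`μ ≥ 1`, `r ≥ 1`). [folklore] -/
theorem rpow_aexp_sub_le {r : ℝ} (hr : 1 ≤ r) :
    D.μ ^ (aexp d - ((Fintype.card d : ℝ) - 1) / r) ≤ D.μ ^ aexp d := by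
  refine Real.rpow_le_rpow_of_exponent_le h.hμ ?_
  have h1 : (1 : ℝ) ≤ Fintype.card d := by
    have := h.hd
    exact_mod_cast (by omega : 1 ≤ Fintype.card d)
  have : 0 ≤ ((Fintype.card d : ℝ) - 1) / r := div_nonneg (by linarith) (by linarith)
  linarith

include h hC in
/-- `‖∑ⱼ|∂ⱼP_x|‖_{L^r} ≤ d C σ⁻¹ μ^{a-1-(d-1)/r}` (`1 ≤ r ≤ 2`). [folklore] -/
theorem eLpNorm_sum_abs_dP_le (x : Index d) {r : ℝ} (hr : 1 ≤ r) (hr2 : r ≤ 2) :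
    eLpNorm (fun y => ∑ j, |Torus.partialDeriv j (D.P x) y|) (ENNReal.ofReal r) volume ≤
      ENNReal.ofReal (Fintype.card d * (C * (D.σ : ℝ)⁻¹ * D.μ ^ (aexp d - 1 - ((Fintype.card d : ℝ) - 1) / r))) := by
  have hr1 : (1 : ℝ≥0∞) ≤ ENNReal.ofReal r := by rw [← ENNReal.ofReal_one]; exact ENNReal.ofReal_le_ofReal hr
  have hσ0 : (0 : ℝ) ≤ (D.σ : ℝ)⁻¹ := by positivity
  have hμ0 : 0 ≤ D.μ := by linarith [h.hμ]
  have hK0 : 0 ≤ C * (D.σ : ℝ)⁻¹ * D.μ ^ (aexp d - 1 - ((Fintype.card d : ℝ) - 1) / r) :=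
    mul_nonneg (mul_nonneg hC.nonneg hσ0) (Real.rpow_nonneg hμ0 _)
  have hmeas : ∀ j, AEStronglyMeasurable (Torus.partialDeriv j (D.P x)) volume := fun j =>
    ((isSmooth_P h x).partialDeriv j).continuous.aestronglyMeasurable
  have h1 := Torus.eLpNorm_le_of_norm_le_sum (E := ℝ) Finset.univ
    (F := fun y => ∑ j, |Torus.partialDeriv j (D.P x) y|) (c := fun _ => (1 : ℝ))
    (K := fun _ => C * (D.σ : ℝ)⁻¹ * D.μ ^ (aexp d - 1 - ((Fintype.card d : ℝ) - 1) / r))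
    (m := fun j => Torus.partialDeriv j (D.P x)) (fun _ _ => zero_le_one) (fun _ _ => hK0)
    (fun j _ => hmeas j) (fun j _ => hC.dP_Lp x j r hr hr2) (fun y => ?_) hr1
  · simpa [Finset.sum_const, Finset.card_univ] using h1
  · rw [Real.norm_eq_abs, abs_of_nonneg (Finset.sum_nonneg fun _ _ => abs_nonneg _)]
    exact le_of_eq (Finset.sum_congr rfl fun j _ => (one_mul _).symm)

include hC in
/-- `∑ⱼ|∂ⱼP_x(y)| ≤ d C σ⁻¹ μ^{a-1}`. [folklore] -/
theorem sum_abs_dP_le (x : Index d) (y : UnitAddTorus d) :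
    ∑ j, |Torus.partialDeriv j (D.P x) y| ≤ Fintype.card d * (C * (D.σ : ℝ)⁻¹ * D.μ ^ (aexp d - 1)) := by
  calc ∑ j, |Torus.partialDeriv j (D.P x) y| ≤ ∑ _j : d, C * (D.σ : ℝ)⁻¹ * D.μ ^ (aexp d - 1) :=
        Finset.sum_le_sum fun j _ => hC.dP_sup x j y
    _ = Fintype.card d * (C * (D.σ : ℝ)⁻¹ * D.μ ^ (aexp d - 1)) := by
        rw [Finset.sum_const, Finset.card_univ, nsmul_eq_mul]

include hC in
/-- `∑ⱼ|∂ᵢ∂ⱼP_x(y)| ≤ d C μ^a`. [folklore] -/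
theorem sum_abs_ddP_le (x : Index d) (i : d) (y : UnitAddTorus d) :
    ∑ j, |Torus.partialDeriv i (Torus.partialDeriv j (D.P x)) y| ≤ Fintype.card d * (C * D.μ ^ aexp d) := by
  calc ∑ j, |Torus.partialDeriv i (Torus.partialDeriv j (D.P x)) y| ≤ ∑ _j : d, C * D.μ ^ aexp d :=
        Finset.sum_le_sum fun j _ => hC.ddP_sup x i j y
    _ = Fintype.card d * (C * D.μ ^ aexp d) := by rw [Finset.sum_const, Finset.card_univ, nsmul_eq_mul]

include h hC in
/-- `‖∑ⱼ|∂ⱼP_x| + ∑ⱼ|∂ᵢ∂ⱼP_x|‖_{L^r} ≤ 2 d C μ^{a-(d-1)/r}` (`1 ≤ r ≤ 2`; the first sum is smaller by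
`σ⁻¹μ⁻¹ ≤ 1`). [folklore] -/
theorem eLpNorm_sum_abs_dP_add_ddP_le (x : Index d) (i : d) {r : ℝ} (hr : 1 ≤ r) (hr2 : r ≤ 2) :
    eLpNorm (fun y => (∑ j, |Torus.partialDeriv j (D.P x) y|) + ∑ j, |Torus.partialDeriv i (Torus.partialDeriv j (D.P x)) y|)
        (ENNReal.ofReal r) volume ≤
      ENNReal.ofReal (2 * Fintype.card d * (C * D.μ ^ (aexp d - ((Fintype.card d : ℝ) - 1) / r))) := by
  have hr1 : (1 : ℝ≥0∞) ≤ ENNReal.ofReal r := by rw [← ENNReal.ofReal_one]; exact ENNReal.ofReal_le_ofReal hr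
  have hμ := h.hμ
  have hμ0 : 0 ≤ D.μ := by linarith
  have hσ1 : (1 : ℝ) ≤ D.σ := by exact_mod_cast h.hσ
  set e : ℝ := aexp d - ((Fintype.card d : ℝ) - 1) / r with he
  have hK0 : 0 ≤ C * D.μ ^ e := mul_nonneg hC.nonneg (Real.rpow_nonneg hμ0 _)
  have hP := isSmooth_P h x
  have hmeas1 : ∀ j, AEStronglyMeasurable (Torus.partialDeriv j (D.P x)) volume := fun j =>
    (hP.partialDeriv j).continuous.aestronglyMeasurable
  have hmeas2 : ∀ j, AEStronglyMeasurable (Torus.partialDeriv i (Torus.partialDeriv j (D.P x))) volume := fun j =>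
    ((hP.partialDeriv j).partialDeriv i).continuous.aestronglyMeasurable
  -- the first-order blocks are smaller: `σ⁻¹ μ^{a-1-(d-1)/r} ≤ μ^{a-(d-1)/r}`
  have hsmall : C * (D.σ : ℝ)⁻¹ * D.μ ^ (aexp d - 1 - ((Fintype.card d : ℝ) - 1) / r) ≤ C * D.μ ^ e := by
    have h1 : (D.σ : ℝ)⁻¹ ≤ 1 := inv_le_one_of_one_le₀ hσ1
    have h2 : D.μ ^ (aexp d - 1 - ((Fintype.card d : ℝ) - 1) / r) ≤ D.μ ^ e :=
      Real.rpow_le_rpow_of_exponent_le hμ (by rw [he]; linarith)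
    have h3 : C * (D.σ : ℝ)⁻¹ ≤ C := by
      have := mul_le_mul_of_nonneg_left h1 hC.nonneg; simpa using this
    exact mul_le_mul h3 h2 (Real.rpow_nonneg hμ0 _) hC.nonneg
  have hb1 : ∀ j, eLpNorm (Torus.partialDeriv j (D.P x)) (ENNReal.ofReal r) volume ≤ ENNReal.ofReal (C * D.μ ^ e) :=
    fun j => (hC.dP_Lp x j r hr hr2).trans (ENNReal.ofReal_le_ofReal hsmall)
  have hb2 : ∀ j, eLpNorm (Torus.partialDeriv i (Torus.partialDeriv j (D.P x))) (ENNReal.ofReal r) volume ≤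
      ENNReal.ofReal (C * D.μ ^ e) := fun j => hC.ddP_Lp x i j r hr hr2
  -- majorant over `d ⊕ d`
  have h1 := Torus.eLpNorm_le_of_norm_le_sum (E := ℝ) (Finset.univ : Finset (d ⊕ d))
    (F := fun y => (∑ j, |Torus.partialDeriv j (D.P x) y|) + ∑ j, |Torus.partialDeriv i (Torus.partialDeriv j (D.P x)) y|)
    (c := fun _ => (1 : ℝ)) (K := fun _ => C * D.μ ^ e)
    (m := fun q => Sum.elim (fun j => Torus.partialDeriv j (D.P x)) (fun j => Torus.partialDeriv i (Torus.partialDeriv j (D.P x))) q)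
    (fun _ _ => zero_le_one) (fun _ _ => hK0)
    (fun q _ => by rcases q with j | j <;> simp [hmeas1, hmeas2])
    (fun q _ => by rcases q with j | j <;> simp [hb1, hb2]) (fun y => ?_) hr1
  · refine h1.trans (le_of_eq ?_)
    congr 1
    rw [Finset.sum_const, Finset.card_univ, Fintype.card_sum, nsmul_eq_mul]
    push_cast
    ring
  · rw [Real.norm_eq_abs, abs_of_nonneg (by positivity), Fintype.sum_sum_type]
    simp

end Slice

/-! ## Slice bounds of the fields -/

section FieldSlices

include hA hC in
/-- **`‖w^{(p)}(t,y)‖ ≤ ∑_x 3ACμ^a |G_x(t)|`** on `[0,T]`. [cite: CheskidovLuo2022, Prop. 5.3] -/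
theorem norm_wp_le_sum {t : ℝ} (ht : t ∈ Icc 0 D.T) (y : UnitAddTorus d) :
    ‖D.wp t y‖ ≤ ∑ x, (3 * A * C * D.μ ^ aexp d) * |D.G x t| := by
  refine (Torus.norm_le_sum_of_norm_le_sum Finset.univ (c := fun x => 3 * A * |D.G x t|) (M := fun _ => C * D.μ ^ aexp d)
    (m := fun x => D.Ψ x) (fun x _ => by have := hA.nonneg; positivity) (fun x _ y => hC.Ψ_sup x y)
    (norm_wp_le hA ht) y).trans (le_of_eq ?_)
  exact Finset.sum_congr rfl fun x _ => by ring

include hA hC in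
/-- **`‖w^{(p)}(t)‖_{L^∞} ≤ ∑_x 3ACμ^a |G_x(t)|`**. [cite: CheskidovLuo2022, Prop. 5.3] -/
theorem eLpNorm_wp_top_le {t : ℝ} (ht : t ∈ Icc 0 D.T) :
    eLpNorm (D.wp t) ⊤ volume ≤ ENNReal.ofReal (∑ x, (3 * A * C * D.μ ^ aexp d) * |D.G x t|) :=
  Torus.eLpNorm_le_of_forall_norm_le (norm_wp_le_sum hA hC ht) ⊤

include h hA hC in
/-- **`‖w^{(p)}(t)‖_{L^r} ≤ ∑_x 3ACμ^{a-(d-1)/r} |G_x(t)|`** (`1 ≤ r ≤ 2`). [cite: CheskidovLuo2022, Prop. 5.3] -/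
theorem eLpNorm_wp_le {t : ℝ} (ht : t ∈ Icc 0 D.T) {r : ℝ} (hr : 1 ≤ r) (hr2 : r ≤ 2) :
    eLpNorm (D.wp t) (ENNReal.ofReal r) volume ≤
      ENNReal.ofReal (∑ x, (3 * A * C * D.μ ^ (aexp d - ((Fintype.card d : ℝ) - 1) / r)) * |D.G x t|) := by
  have hr1 : (1 : ℝ≥0∞) ≤ ENNReal.ofReal r := by rw [← ENNReal.ofReal_one]; exact ENNReal.ofReal_le_ofReal hr
  have hμ0 : 0 ≤ D.μ := by linarith [h.hμ]
  have hK0 : 0 ≤ C * D.μ ^ (aexp d - ((Fintype.card d : ℝ) - 1) / r) := mul_nonneg hC.nonneg (Real.rpow_nonneg hμ0 _)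
  refine (Torus.eLpNorm_le_of_norm_le_sum Finset.univ (F := D.wp t) (c := fun x => 3 * A * |D.G x t|)
    (K := fun _ => C * D.μ ^ (aexp d - ((Fintype.card d : ℝ) - 1) / r)) (m := fun x => D.Ψ x)
    (fun x _ => by have := hA.nonneg; positivity) (fun _ _ => hK0)
    (fun x _ => (isSmooth_Ψ h x).continuous.aestronglyMeasurable) (fun x _ => hC.Ψ_Lp x r hr hr2)
    (norm_wp_le hA ht) hr1).trans (le_of_eq ?_)
  congr 1
  exact Finset.sum_congr rfl fun x _ => by ring

include h hA hC in
/-- **`‖w^{(c)}(t,y)‖ ≤ ∑_x 6AdCσ⁻¹μ^{a-1} |G_x(t)|`** on `[0,T]`. [cite: CheskidovLuo2022, Prop. 5.4] -/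
theorem norm_wc_le_sum {t : ℝ} (ht : t ∈ Icc 0 D.T) (y : UnitAddTorus d) :
    ‖D.wc t y‖ ≤ ∑ x, (6 * A * (Fintype.card d * (C * (D.σ : ℝ)⁻¹ * D.μ ^ (aexp d - 1)))) * |D.G x t| := by
  refine (Torus.norm_le_sum_of_norm_le_sum Finset.univ (c := fun x => 6 * A * |D.G x t|)
    (M := fun _ => Fintype.card d * (C * (D.σ : ℝ)⁻¹ * D.μ ^ (aexp d - 1)))
    (m := fun x y => ∑ j, |Torus.partialDeriv j (D.P x) y|) (fun x _ => by have := hA.nonneg; positivity)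
    (fun x _ y => ?_) (norm_wc_le h hA ht) y).trans (le_of_eq (Finset.sum_congr rfl fun x _ => by ring))
  rw [abs_of_nonneg (Finset.sum_nonneg fun _ _ => abs_nonneg _)]
  exact sum_abs_dP_le hC x y

include h hA hC in
/-- **`‖w^{(c)}(t)‖_{L^∞} ≤ ∑_x 6AdCσ⁻¹μ^{a-1} |G_x(t)|`**. [cite: CheskidovLuo2022, Prop. 5.4] -/
theorem eLpNorm_wc_top_le {t : ℝ} (ht : t ∈ Icc 0 D.T) :
    eLpNorm (D.wc t) ⊤ volume ≤
      ENNReal.ofReal (∑ x, (6 * A * (Fintype.card d * (C * (D.σ : ℝ)⁻¹ * D.μ ^ (aexp d - 1)))) * |D.G x t|) :=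
  Torus.eLpNorm_le_of_forall_norm_le (norm_wc_le_sum h hA hC ht) ⊤

include h hA hC in
/-- **`‖w^{(c)}(t)‖_{L^r} ≤ ∑_x 6AdCσ⁻¹μ^{a-1-(d-1)/r} |G_x(t)|`** (`1 ≤ r ≤ 2`). [cite: CheskidovLuo2022, Prop. 5.4] -/
theorem eLpNorm_wc_le {t : ℝ} (ht : t ∈ Icc 0 D.T) {r : ℝ} (hr : 1 ≤ r) (hr2 : r ≤ 2) :
    eLpNorm (D.wc t) (ENNReal.ofReal r) volume ≤
      ENNReal.ofReal (∑ x, (6 * A * (Fintype.card d * (C * (D.σ : ℝ)⁻¹ * D.μ ^ (aexp d - 1 - ((Fintype.card d : ℝ) - 1) / r)))) *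
        |D.G x t|) := by
  have hr1 : (1 : ℝ≥0∞) ≤ ENNReal.ofReal r := by rw [← ENNReal.ofReal_one]; exact ENNReal.ofReal_le_ofReal hr
  have hμ0 : 0 ≤ D.μ := by linarith [h.hμ]
  have hK0 : 0 ≤ Fintype.card d * (C * (D.σ : ℝ)⁻¹ * D.μ ^ (aexp d - 1 - ((Fintype.card d : ℝ) - 1) / r)) := by
    have := hC.nonneg; positivity
  have hP := fun x => isSmooth_P h x
  refine (Torus.eLpNorm_le_of_norm_le_sum Finset.univ (F := D.wc t) (c := fun x => 6 * A * |D.G x t|)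
    (K := fun _ => Fintype.card d * (C * (D.σ : ℝ)⁻¹ * D.μ ^ (aexp d - 1 - ((Fintype.card d : ℝ) - 1) / r)))
    (m := fun x y => ∑ j, |Torus.partialDeriv j (D.P x) y|)
    (fun x _ => by have := hA.nonneg; positivity) (fun _ _ => hK0)
    (fun x _ => (continuous_finsetSum _ fun j _ => ((hP x).partialDeriv j).continuous.abs).aestronglyMeasurable)
    (fun x _ => eLpNorm_sum_abs_dP_le h hC x hr hr2) (norm_wc_le h hA ht) hr1).trans (le_of_eq ?_)
  congr 1
  exact Finset.sum_congr rfl fun x _ => by ring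

include h hA hC in
/-- **`‖∂ᵢw^{(p)}(t)‖_{L^r} ≤ ∑_x 6ACσμ^{a+1-(d-1)/r} |G_x(t)|`** (`1 ≤ r ≤ 2`; CL22 Prop. 5.3, the
`W^{1,q}` part: "`‖𝐖_k(σ·)‖_{W^{1,q}} ≲ σμ μ^{(d-1)/2-(d-1)/q}`"). [cite: CheskidovLuo2022, Prop. 5.3] -/
theorem eLpNorm_partialDeriv_wp_le {t : ℝ} (ht : t ∈ Icc 0 D.T) (i : d) {r : ℝ} (hr : 1 ≤ r) (hr2 : r ≤ 2) :
    eLpNorm (Torus.partialDeriv i (D.wp t)) (ENNReal.ofReal r) volume ≤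
      ENNReal.ofReal (∑ x, (6 * A * C * D.σ * D.μ ^ (aexp d + 1 - ((Fintype.card d : ℝ) - 1) / r)) * |D.G x t|) := by
  have hr1 : (1 : ℝ≥0∞) ≤ ENNReal.ofReal r := by rw [← ENNReal.ofReal_one]; exact ENNReal.ofReal_le_ofReal hr
  have hμ := h.hμ
  have hμ0 : 0 ≤ D.μ := by linarith
  have hσ1 : (1 : ℝ) ≤ D.σ := by exact_mod_cast h.hσ
  set e : ℝ := aexp d + 1 - ((Fintype.card d : ℝ) - 1) / r with he
  have hK0 : 0 ≤ 2 * C * D.σ * D.μ ^ e := by have := hC.nonneg; positivity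
  have hΨ := fun x => isSmooth_Ψ h x
  -- `‖ |Ψ| + |∂ᵢΨ| ‖_{L^r} ≤ 2Cσμ^e`
  have hblock : ∀ x, eLpNorm (fun y => |D.Ψ x y| + |Torus.partialDeriv i (D.Ψ x) y|) (ENNReal.ofReal r) volume ≤
      ENNReal.ofReal (2 * C * D.σ * D.μ ^ e) := by
    intro x
    have h1 : eLpNorm (fun y => |D.Ψ x y| + |Torus.partialDeriv i (D.Ψ x) y|) (ENNReal.ofReal r) volume ≤
        eLpNorm (fun y => |D.Ψ x y|) (ENNReal.ofReal r) volume +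
          eLpNorm (fun y => |Torus.partialDeriv i (D.Ψ x) y|) (ENNReal.ofReal r) volume :=
      eLpNorm_add_le (hΨ x).continuous.abs.aestronglyMeasurable ((hΨ x).partialDeriv i).continuous.abs.aestronglyMeasurable hr1
    have e1 : (fun y => |D.Ψ x y|) = fun y => ‖D.Ψ x y‖ := by funext y; rw [Real.norm_eq_abs]
    have e2 : (fun y => |Torus.partialDeriv i (D.Ψ x) y|) = fun y => ‖Torus.partialDeriv i (D.Ψ x) y‖ := by
      funext y; rw [Real.norm_eq_abs]
    rw [e1, e2, eLpNorm_norm, eLpNorm_norm] at h1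
    refine h1.trans ?_
    have b1 := hC.Ψ_Lp x r hr hr2
    have b2 := hC.dΨ_Lp x i r hr hr2
    have hsmall : C * D.μ ^ (aexp d - ((Fintype.card d : ℝ) - 1) / r) ≤ C * D.σ * D.μ ^ e := by
      have h2 : D.μ ^ (aexp d - ((Fintype.card d : ℝ) - 1) / r) ≤ D.μ ^ e :=
        Real.rpow_le_rpow_of_exponent_le hμ (by rw [he]; linarith)
      have h3 : C ≤ C * D.σ := by have := mul_le_mul_of_nonneg_left hσ1 hC.nonneg; simpa using this
      exact mul_le_mul h3 h2 (Real.rpow_nonneg hμ0 _) (mul_nonneg hC.nonneg (by positivity))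
    calc eLpNorm (D.Ψ x) (ENNReal.ofReal r) volume + eLpNorm (Torus.partialDeriv i (D.Ψ x)) (ENNReal.ofReal r) volume
        ≤ ENNReal.ofReal (C * D.σ * D.μ ^ e) + ENNReal.ofReal (C * D.σ * D.μ ^ e) :=
          add_le_add (b1.trans (ENNReal.ofReal_le_ofReal hsmall)) b2
      _ = ENNReal.ofReal (2 * C * D.σ * D.μ ^ e) := by
          rw [← ENNReal.ofReal_add (by have := hC.nonneg; positivity) (by have := hC.nonneg; positivity)]; ring_nf
  refine (Torus.eLpNorm_le_of_norm_le_sum Finset.univ (F := Torus.partialDeriv i (D.wp t)) (c := fun x => 3 * A * |D.G x t|)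
    (K := fun _ => 2 * C * D.σ * D.μ ^ e) (m := fun x y => |D.Ψ x y| + |Torus.partialDeriv i (D.Ψ x) y|)
    (fun x _ => by have := hA.nonneg; positivity) (fun _ _ => hK0)
    (fun x _ => ((hΨ x).continuous.abs.add ((hΨ x).partialDeriv i).continuous.abs).aestronglyMeasurable)
    (fun x _ => hblock x) (norm_partialDeriv_wp_le h hA ht i) hr1).trans (le_of_eq ?_)
  congr 1
  exact Finset.sum_congr rfl fun x _ => by ring

include h hA hC in
/-- **`‖∂ᵢw^{(c)}(t)‖_{L^r} ≤ ∑_x 12AdCμ^{a-(d-1)/r} |G_x(t)|`** (`1 ≤ r ≤ 2`). [cite: CheskidovLuo2022, Prop. 5.4] -/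
theorem eLpNorm_partialDeriv_wc_le {t : ℝ} (ht : t ∈ Icc 0 D.T) (i : d) {r : ℝ} (hr : 1 ≤ r) (hr2 : r ≤ 2) :
    eLpNorm (Torus.partialDeriv i (D.wc t)) (ENNReal.ofReal r) volume ≤
      ENNReal.ofReal (∑ x, (12 * A * Fintype.card d * (C * D.μ ^ (aexp d - ((Fintype.card d : ℝ) - 1) / r))) * |D.G x t|) := by
  have hr1 : (1 : ℝ≥0∞) ≤ ENNReal.ofReal r := by rw [← ENNReal.ofReal_one]; exact ENNReal.ofReal_le_ofReal hr
  have hμ0 : 0 ≤ D.μ := by linarith [h.hμ]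
  have hK0 : 0 ≤ 2 * Fintype.card d * (C * D.μ ^ (aexp d - ((Fintype.card d : ℝ) - 1) / r)) := by
    have := hC.nonneg; positivity
  have hP := fun x => isSmooth_P h x
  refine (Torus.eLpNorm_le_of_norm_le_sum Finset.univ (F := Torus.partialDeriv i (D.wc t)) (c := fun x => 6 * A * |D.G x t|)
    (K := fun _ => 2 * Fintype.card d * (C * D.μ ^ (aexp d - ((Fintype.card d : ℝ) - 1) / r)))
    (m := fun x y => (∑ j, |Torus.partialDeriv j (D.P x) y|) + ∑ j, |Torus.partialDeriv i (Torus.partialDeriv j (D.P x)) y|)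
    (fun x _ => by have := hA.nonneg; positivity) (fun _ _ => hK0)
    (fun x _ => ((continuous_finsetSum _ fun j _ => ((hP x).partialDeriv j).continuous.abs).add
      (continuous_finsetSum _ fun j _ => (((hP x).partialDeriv j).partialDeriv i).continuous.abs)).aestronglyMeasurable)
    (fun x _ => eLpNorm_sum_abs_dP_add_ddP_le h hC x i hr hr2) (norm_partialDeriv_wc_le h hA ht i) hr1).trans (le_of_eq ?_)
  congr 1
  exact Finset.sum_congr rfl fun x _ => by ring

end FieldSlices

/-! ## Time integration -/

section Integrated

include h hA in
/-- **From slice bounds `∑_x K|G_x(t)|` to `L¹_t`**: `‖Z‖_{L¹(0,T;L^p)} ≤ N K (T+1) κ^{-1/2} A`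
(the gain of intermittency, CL22 (4.12) with `p = 1`). [cite: CheskidovLuo2022, §4.2 (4.12)] -/
theorem eLqLpNorm_one_le_of_slice_G {E : Type*} [NormedAddCommGroup E] {Z : ℝ → UnitAddTorus d → E} {p : ℝ≥0∞}
    {K : ℝ} (hK : 0 ≤ K) (hle : ∀ t ∈ Ioo 0 D.T, eLpNorm (Z t) p volume ≤ ENNReal.ofReal (∑ x, K * |D.G x t|)) :
    eLqLpNorm 1 p Z (Ioo 0 D.T) ≤
      ENNReal.ofReal (Fintype.card (Index d) * K * ((D.T + 1) * D.κ ^ (-(1 / 2 : ℝ)) * A)) := by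
  refine (Torus.eLqLpNorm_one_le_sum_mul_integral Finset.univ h.hT.le (fun _ _ => hK) (fun x _ => continuousOn_G h x) hle).trans
    (ENNReal.ofReal_le_ofReal ?_)
  calc ∑ x, K * ∫ t in (0 : ℝ)..D.T, |D.G x t| ≤ ∑ _x : Index d, K * ((D.T + 1) * D.κ ^ (-(1 / 2 : ℝ)) * A) :=
        Finset.sum_le_sum fun x _ => mul_le_mul_of_nonneg_left (intervalIntegral_abs_G_le h hA x) hK
    _ = Fintype.card (Index d) * K * ((D.T + 1) * D.κ ^ (-(1 / 2 : ℝ)) * A) := by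
        rw [Finset.sum_const, Finset.card_univ, nsmul_eq_mul]; ring

include h hA in
/-- **From slice bounds `∑_x K|G_x(t)|` to `L^q_t`** (`q ≥ 1` real):
`‖Z‖_{L^q(0,T;L^p)} ≤ N K ((T+1) κ^{q/2-1} A^q)^{1/q}` (CL22 (4.12)). [cite: CheskidovLuo2022, §4.2 (4.12)] -/
theorem eLqLpNorm_le_of_slice_G {E : Type*} [NormedAddCommGroup E] {Z : ℝ → UnitAddTorus d → E} {p : ℝ≥0∞}
    {K : ℝ} (hK : 0 ≤ K) {q : ℝ} (hq : 1 ≤ q)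
    (hle : ∀ t ∈ Ioo 0 D.T, eLpNorm (Z t) p volume ≤ ENNReal.ofReal (∑ x, K * |D.G x t|)) :
    eLqLpNorm (ENNReal.ofReal q) p Z (Ioo 0 D.T) ≤
      ENNReal.ofReal (Fintype.card (Index d) * K * ((D.T + 1) * D.κ ^ (q / 2 - 1) * A ^ q) ^ (1 / q)) := by
  have hq1 : (1 : ℝ≥0∞) ≤ ENNReal.ofReal q := by rw [← ENNReal.ofReal_one]; exact ENNReal.ofReal_le_ofReal hq
  refine (Torus.eLqLpNorm_le_sum_mul_eLpNorm Finset.univ (fun _ _ => hK) (fun x _ => continuousOn_G h x) hq1 hle).trans ?_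
  have hB : ∀ x, eLpNorm (D.G x) (ENNReal.ofReal q) (volume.restrict (Ioo 0 D.T)) ≤
      ENNReal.ofReal (((D.T + 1) * D.κ ^ (q / 2 - 1) * A ^ q) ^ (1 / q)) := fun x =>
    Torus.eLpNorm_restrict_Ioo_le_of_integral_rpow_le h.hT.le (continuousOn_G h x) hq (intervalIntegral_abs_G_rpow_le h hA x hq)
  calc ∑ x, ENNReal.ofReal K * eLpNorm (D.G x) (ENNReal.ofReal q) (volume.restrict (Ioo 0 D.T))
      ≤ ∑ _x : Index d, ENNReal.ofReal K * ENNReal.ofReal (((D.T + 1) * D.κ ^ (q / 2 - 1) * A ^ q) ^ (1 / q)) :=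
        Finset.sum_le_sum fun x _ => mul_le_mul' le_rfl (hB x)
    _ = ENNReal.ofReal (Fintype.card (Index d) * K * ((D.T + 1) * D.κ ^ (q / 2 - 1) * A ^ q) ^ (1 / q)) := by
        rw [Finset.sum_const, Finset.card_univ, nsmul_eq_mul, ← ENNReal.ofReal_mul hK, ← ENNReal.ofReal_natCast,
          ← ENNReal.ofReal_mul (Nat.cast_nonneg _)]
        ring_nf

include h hA hC in
/-- **`‖w^{(p)}‖_{L^p(0,T;L^∞)} ≤ 3NACμ^a ((T+1)κ^{p/2-1}A^p)^{1/p}`** (`p ≥ 1`; CL22 Prop. 5.3: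
"`‖w^{(p)}‖_{L^pL^∞} ≤ C_u κ^{1/2-1/p} μ^{(d-1)/2}`"). [cite: CheskidovLuo2022, Prop. 5.3] -/
theorem eLqLpNorm_wp_top_le {p : ℝ} (hp : 1 ≤ p) :
    eLqLpNorm (ENNReal.ofReal p) ⊤ D.wp (Ioo 0 D.T) ≤
      ENNReal.ofReal (Fintype.card (Index d) * (3 * A * C * D.μ ^ aexp d) * ((D.T + 1) * D.κ ^ (p / 2 - 1) * A ^ p) ^ (1 / p)) :=
  eLqLpNorm_le_of_slice_G h hA (by have := hA.nonneg; have := hC.nonneg; have : 0 ≤ D.μ := zero_le_one.trans h.hμ; positivity) hp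
    fun t ht => eLpNorm_wp_top_le hA hC (Ioo_subset_Icc_self ht)

include h hA hC in
/-- **`‖w^{(c)}‖_{L^q(0,T;L^∞)} ≤ 6NAdCσ⁻¹μ^{a-1} ((T+1)κ^{q/2-1}A^q)^{1/q}`** (`q ≥ 1`; CL22 Prop. 5.4:
"`‖w^{(c)}‖_{L²L^∞} ≤ C_u σ⁻¹ μ^{-1+(d-1)/2}`"). [cite: CheskidovLuo2022, Prop. 5.4] -/
theorem eLqLpNorm_wc_top_le {q : ℝ} (hq : 1 ≤ q) :
    eLqLpNorm (ENNReal.ofReal q) ⊤ D.wc (Ioo 0 D.T) ≤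
      ENNReal.ofReal (Fintype.card (Index d) * (6 * A * (Fintype.card d * (C * (D.σ : ℝ)⁻¹ * D.μ ^ (aexp d - 1)))) *
        ((D.T + 1) * D.κ ^ (q / 2 - 1) * A ^ q) ^ (1 / q)) :=
  eLqLpNorm_le_of_slice_G h hA (by have := hA.nonneg; have := hC.nonneg; have : 0 ≤ D.μ := zero_le_one.trans h.hμ; positivity) hq
    fun t ht => eLpNorm_wc_top_le h hA hC (Ioo_subset_Icc_self ht)

include h hA in
/-- **`‖w^{(t)}‖_{L^q(0,T;L^s)} ≤ max(1,T) N ν⁻¹ A`** (`q ≥ 1`; CL22 Prop. 5.5). [cite: CheskidovLuo2022, Prop. 5.5] -/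
theorem eLqLpNorm_wt_le {q : ℝ≥0∞} (hq : 1 ≤ q) (s : ℝ≥0∞) :
    eLqLpNorm q s D.wt (Ioo 0 D.T) ≤ ENNReal.ofReal (max 1 D.T * (Fintype.card (Index d) * D.ν⁻¹ * A)) :=
  Torus.eLqLpNorm_le_of_forall_norm_le (by have := hA.nonneg; have : 0 ≤ D.ν⁻¹ := inv_nonneg.2 (by linarith [h.hν]); positivity)
    hq s fun t ht y => norm_wt_le h hA (Ioo_subset_Icc_self ht) y

include h hA in
/-- **`‖∂ᵢw^{(t)}‖_{L^q(0,T;L^s)} ≤ max(1,T) N ν⁻¹ A`** (`q ≥ 1`; CL22 Prop. 5.5). [cite: CheskidovLuo2022, Prop. 5.5] -/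
theorem eLqLpNorm_partialDeriv_wt_le {q : ℝ≥0∞} (hq : 1 ≤ q) (s : ℝ≥0∞) (i : d) :
    eLqLpNorm q s (fun t => Torus.partialDeriv i (D.wt t)) (Ioo 0 D.T) ≤
      ENNReal.ofReal (max 1 D.T * (Fintype.card (Index d) * D.ν⁻¹ * A)) :=
  Torus.eLqLpNorm_le_of_forall_norm_le (by have := hA.nonneg; have : 0 ≤ D.ν⁻¹ := inv_nonneg.2 (by linarith [h.hν]); positivity)
    hq s fun t ht y => norm_partialDeriv_wt_le h hA (Ioo_subset_Icc_self ht) i y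

include h hA hC in
/-- **`‖w^{(p)}‖_{L¹(0,T;L^r)} ≤ 3NACμ^{a-(d-1)/r} (T+1)κ^{-1/2}A`** (`1 ≤ r ≤ 2`). [cite: CheskidovLuo2022, Lemma 5.6] -/
theorem eLqLpNorm_one_wp_le {r : ℝ} (hr : 1 ≤ r) (hr2 : r ≤ 2) :
    eLqLpNorm 1 (ENNReal.ofReal r) D.wp (Ioo 0 D.T) ≤
      ENNReal.ofReal (Fintype.card (Index d) * (3 * A * C * D.μ ^ (aexp d - ((Fintype.card d : ℝ) - 1) / r)) *
        ((D.T + 1) * D.κ ^ (-(1 / 2 : ℝ)) * A)) :=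
  eLqLpNorm_one_le_of_slice_G h hA (by have := hA.nonneg; have := hC.nonneg; have : 0 ≤ D.μ := zero_le_one.trans h.hμ; positivity)
    fun t ht => eLpNorm_wp_le h hA hC (Ioo_subset_Icc_self ht) hr hr2

include h hA hC in
/-- **`‖w^{(c)}‖_{L¹(0,T;L^r)} ≤ 6NAdCσ⁻¹μ^{a-1-(d-1)/r} (T+1)κ^{-1/2}A`** (`1 ≤ r ≤ 2`). [cite: CheskidovLuo2022, Lemma 5.6] -/
theorem eLqLpNorm_one_wc_le {r : ℝ} (hr : 1 ≤ r) (hr2 : r ≤ 2) :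
    eLqLpNorm 1 (ENNReal.ofReal r) D.wc (Ioo 0 D.T) ≤
      ENNReal.ofReal (Fintype.card (Index d) *
        (6 * A * (Fintype.card d * (C * (D.σ : ℝ)⁻¹ * D.μ ^ (aexp d - 1 - ((Fintype.card d : ℝ) - 1) / r)))) *
        ((D.T + 1) * D.κ ^ (-(1 / 2 : ℝ)) * A)) :=
  eLqLpNorm_one_le_of_slice_G h hA (by have := hA.nonneg; have := hC.nonneg; have : 0 ≤ D.μ := zero_le_one.trans h.hμ; positivity)
    fun t ht => eLpNorm_wc_le h hA hC (Ioo_subset_Icc_self ht) hr hr2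

include h hA hC in
/-- **`‖∂ᵢw^{(p)}‖_{L¹(0,T;L^r)} ≤ 6NACσμ^{a+1-(d-1)/r} (T+1)κ^{-1/2}A`** (`1 ≤ r ≤ 2`; CL22 Prop. 5.3:
"`‖w^{(p)}‖_{L¹W^{1,q}} ≲ σκ^{-1/2}μμ^{(d-1)/2-(d-1)/q}`"). [cite: CheskidovLuo2022, Prop. 5.3] -/
theorem eLqLpNorm_one_partialDeriv_wp_le (i : d) {r : ℝ} (hr : 1 ≤ r) (hr2 : r ≤ 2) :
    eLqLpNorm 1 (ENNReal.ofReal r) (fun t => Torus.partialDeriv i (D.wp t)) (Ioo 0 D.T) ≤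
      ENNReal.ofReal (Fintype.card (Index d) * (6 * A * C * D.σ * D.μ ^ (aexp d + 1 - ((Fintype.card d : ℝ) - 1) / r)) *
        ((D.T + 1) * D.κ ^ (-(1 / 2 : ℝ)) * A)) :=
  eLqLpNorm_one_le_of_slice_G h hA (by have := hA.nonneg; have := hC.nonneg; have : 0 ≤ D.μ := zero_le_one.trans h.hμ; positivity)
    fun t ht => eLpNorm_partialDeriv_wp_le h hA hC (Ioo_subset_Icc_self ht) i hr hr2

include h hA hC in
/-- **`‖∂ᵢw^{(c)}‖_{L¹(0,T;L^r)} ≤ 12NAdCμ^{a-(d-1)/r} (T+1)κ^{-1/2}A`** (`1 ≤ r ≤ 2`; CL22 Prop. 5.4: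
"`‖w^{(c)}‖_{L¹W^{1,q}} ≲ κ^{-1/2}μ^{(d-1)/2-(d-1)/q}`"). [cite: CheskidovLuo2022, Prop. 5.4] -/
theorem eLqLpNorm_one_partialDeriv_wc_le (i : d) {r : ℝ} (hr : 1 ≤ r) (hr2 : r ≤ 2) :
    eLqLpNorm 1 (ENNReal.ofReal r) (fun t => Torus.partialDeriv i (D.wc t)) (Ioo 0 D.T) ≤
      ENNReal.ofReal (Fintype.card (Index d) *
        (12 * A * Fintype.card d * (C * D.μ ^ (aexp d - ((Fintype.card d : ℝ) - 1) / r))) *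
        ((D.T + 1) * D.κ ^ (-(1 / 2 : ℝ)) * A)) :=
  eLqLpNorm_one_le_of_slice_G h hA (by have := hA.nonneg; have := hC.nonneg; have : 0 ≤ D.μ := zero_le_one.trans h.hμ; positivity)
    fun t ht => eLpNorm_partialDeriv_wc_le h hA hC (Ioo_subset_Icc_self ht) i hr hr2

end Integrated

end Datum

end CL22

end Literature.Analysis.FluidPDE
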